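import Summits.Parity.GeneralizedHardyLittlewood.Theorems.GreenTaoLevelTwoMNTwoDepolarizeStep
import Summits.Parity.GeneralizedHardyLittlewood.Theorems.GreenTaoLevelTwoMNTwoRecurrentLinearAmplified

/-!
# Route `GreenTaoLevelTwo`, crux `MNTwo` (stmt-Parity-21276), line `birth`, stub `stub_mnVertical`:
# Lemma 27 "major arcs have small second derivative, II" (GT 2008b §11), abstract gauge form

Block V5 of the `stub_mnVertical` census (B. Green, T. Tao, *Quadratic uniformity of the Möbius
function*, Ann. Inst. Fourier 58 (2008) = arXiv:math/0606087, §11 Lemma 27: from the diagonal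
major-arc property of Lemma 26 (`‖φ''(h,h)‖_{ℝ/ℤ,Q₁} ≲ ‖h‖_g²` on `B_g(0,ρ₀)`) to the depolarized
one, `‖φ''(h,h')‖_{ℝ/ℤ,Q₂} ≲ ‖h‖_g‖h'‖_g` for `h, h' ∈ B_g(0,ρ₂)`: "By symmetry we may assume
`‖h'‖_g ≤ ‖h‖_g`. Let `L > 1` be the least integer such that `L‖h'‖_g > ‖h‖_g` … [polarization,
Lemma 26] … By the pigeonhole principle, we can find `q ≤ Q₁` such that `‖qlφ''(h,h')‖ ≲ ‖h‖_g²` for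
`≳ L` values of `l` … apply Lemma 32 (ii) … `‖qφ''(h,h')‖ ≲ ‖h‖²_g/L ≤ ‖h‖_g‖h'‖_g`").  Abstract
symmetric gauge `ν`; `φ : ℤ → ℝ/ℤ` locally quadratic on `B(n₀,R)`; explicit constants; def-free.
Ingredients: `…MNTwoDepolarizeStep.depolarize_step` (per-`l` bound), a pigeonhole over the pairs of
denominators, and `…MNTwoRecurrentLinearAmplified.exists_norm_mul_le_of_many_small_amplified`.

* `exists_popular_value` — pigeonhole of a function on `{1,…,L}` into a finite set;
* `depolarize` — **Lemma 27**: `∃ q ≤ 25672 Q₁⁶`, `‖q•φ''(h,h')‖ ≤ 426133840896 Q₁¹³ K ν(h)ν(h')`.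

References: [GreenTao2008QuadraticMobius] arXiv:math/0606087 §11, Lemma 27.
-/

noncomputable section

open Finset Real

namespace Summit.Parity.GeneralizedHardyLittlewood.GreenTaoLevelTwoMNTwoDepolarize

open Summit.Parity.GeneralizedHardyLittlewood.GreenTaoLevelTwoMNTwoDepolarizeStep (depolarize_step)
open Summit.Parity.GeneralizedHardyLittlewood.GreenTaoLevelTwoMNTwoRecurrentLinearAmplified
  (exists_norm_mul_le_of_many_small_amplified)

/-- Pigeonhole: a function from `{1,…,L}` into a finite set `t` has a fibre of size `≥ L/#t`.
[folklore] -/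
theorem exists_popular_value {β : Type*} [DecidableEq β] (L : ℕ) (t : Finset β) (ht : t.Nonempty)
    (f : ℕ → β) (hf : ∀ l ∈ Icc 1 L, f l ∈ t) :
    ∃ b ∈ t, (L : ℝ) / #t ≤ #((Icc 1 L).filter fun l => f l = b) := by
  classical
  have htpos : (0 : ℝ) < #t := by exact_mod_cast ht.card_pos
  by_contra hcon
  push Not at hcon
  have hsum : #(Icc 1 L) = ∑ b ∈ t, #((Icc 1 L).filter fun l => f l = b) :=
    card_eq_sum_card_fiberwise hf
  have hlt : ((#(Icc 1 L) : ℕ) : ℝ) < ∑ _b ∈ t, (L : ℝ) / #t := by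
    rw [hsum]; push_cast
    exact sum_lt_sum_of_nonempty ht fun b hb => hcon b hb
  rw [sum_const, nsmul_eq_mul, mul_div_cancel₀ _ htpos.ne', Nat.card_Icc] at hlt
  simp at hlt

/-- Final bookkeeping of Lemma 27's large-`L` case. [folklore] -/
theorem large_case_arith {Q₁ K a b L : ℝ} (hQ : 1 ≤ Q₁) (hK : 0 ≤ K) (ha : 0 ≤ a) (hL : 0 < L)
    (hLlt : a ≤ L * b) :
    2630455808 * (162 * Q₁ * K * a ^ 2) / ((1 / Q₁ ^ 2) ^ 6 * L) ≤
      426133840896 * Q₁ ^ 13 * K * a * b := by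
  have hQ0 : Q₁ ≠ 0 := by positivity
  have e1 : (1 / Q₁ ^ 2) ^ 6 * L = L / Q₁ ^ 12 := by field_simp
  rw [e1, div_le_iff₀ (by positivity)]
  have e2 : 426133840896 * Q₁ ^ 13 * K * a * b * (L / Q₁ ^ 12) =
      426133840896 * Q₁ * K * a * (L * b) := by field_simp
  have e3 : (2630455808 : ℝ) * (162 * Q₁ * K * a ^ 2) = 426133840896 * Q₁ * K * a * a := by ring
  rw [e2, e3]
  exact mul_le_mul_of_nonneg_left hLlt (by positivity)

/-- **Lemma 27 (GT 2008b §11), abstract form.**  Let `ν` be a nonnegative symmetric subadditive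
gauge with `ν 0 = 0`, `φ : ℤ → ℝ/ℤ` locally quadratic on `B(n₀,R)`, and suppose the DIAGONAL values
are major arc (Lemma 26): for `ν a < ρ₀` some `1 ≤ q ≤ Q₁` has `‖q•φ''(a,a)‖ ≤ Kν(a)²`.  Let
`ν h' ≤ ν h < ρ₂` with `0 < ν h'`, `9ρ₂ ≤ ρ₀`, `18ρ₂ ≤ R` and `648 Q₁³ K ρ₂² ≤ 1`.  Then there is
`1 ≤ q ≤ 25672 Q₁⁶` with `‖q•φ''(h,h')‖ ≤ 426133840896 · Q₁¹³ K ν(h) ν(h')`.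
[cite: GreenTao2008QuadraticMobius, Lemma 27] -/
theorem depolarize (ν : ℤ → ℝ) (hν0 : ν 0 = 0) (hνnn : ∀ x, 0 ≤ ν x)
    (hνneg : ∀ x, ν (-x) = ν x) (hνadd : ∀ x y, ν (x + y) ≤ ν x + ν y) (φ : ℤ → UnitAddCircle)
    {n₀ : ℤ} {R : ℝ}
    (hφ : ∀ n a b c : ℤ, ν (n - n₀) < R → ν (n + a - n₀) < R → ν (n + b - n₀) < R →
      ν (n + c - n₀) < R → ν (n + a + b - n₀) < R → ν (n + a + c - n₀) < R →
      ν (n + b + c - n₀) < R → ν (n + a + b + c - n₀) < R →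
      φ (n + a + b + c) - φ (n + a + b) - φ (n + a + c) - φ (n + b + c)
        + φ (n + a) + φ (n + b) + φ (n + c) - φ n = 0)
    {ρ₀ ρ₂ Q₁ K : ℝ} (hK : 0 ≤ K) (hQ₁ : 1 ≤ Q₁)
    (h26 : ∀ a : ℤ, ν a < ρ₀ → ∃ q : ℕ, 1 ≤ q ∧ (q : ℝ) ≤ Q₁ ∧
      ‖((q : ℤ)) • (φ (n₀ + a + a) - φ (n₀ + a) - φ (n₀ + a) + φ n₀)‖ ≤ K * ν a ^ 2)
    (hρ : 9 * ρ₂ ≤ ρ₀) (hR : 18 * ρ₂ ≤ R) (hsmall : 648 * Q₁ ^ 3 * K * ρ₂ ^ 2 ≤ 1)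
    {h h' : ℤ} (hh : ν h < ρ₂) (hh'h : ν h' ≤ ν h) (hh'0 : 0 < ν h') :
    ∃ q : ℕ, 1 ≤ q ∧ (q : ℝ) ≤ 25672 * Q₁ ^ 6 ∧
      ‖((q : ℤ)) • (φ (n₀ + h + h') - φ (n₀ + h) - φ (n₀ + h') + φ n₀)‖ ≤
        426133840896 * Q₁ ^ 13 * K * ν h * ν h' := by
  classical
  set D := φ (n₀ + h + h') - φ (n₀ + h) - φ (n₀ + h') + φ n₀ with hD
  have hνh : 0 < ν h := lt_of_lt_of_le hh'0 hh'h
  have hρ₂ : 0 < ρ₂ := lt_of_le_of_lt (hνnn h) hh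
  -- `L = ⌊ν h/ν h'⌋ + 1`: `ν h < L ν h' ≤ ν h + ν h'`
  set L : ℕ := ⌊ν h / ν h'⌋₊ + 1 with hLdef
  have hL1 : 1 ≤ L := by omega
  have hLlt : ν h < L * ν h' := by
    have := Nat.lt_floor_add_one (ν h / ν h')
    rw [hLdef]; push_cast
    rwa [div_lt_iff₀ hh'0] at this
  have hLle : (L : ℝ) * ν h' ≤ ν h + ν h' := by
    have := Nat.floor_le (div_nonneg hνh.le hh'0.le)
    rw [hLdef]; push_cast
    have e : (⌊ν h / ν h'⌋₊ : ℝ) * ν h' ≤ ν h / ν h' * ν h' := mul_le_mul_of_nonneg_right this hh'0.le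
    rw [div_mul_cancel₀ _ hh'0.ne'] at e
    linarith
  -- radius for the per-`l` step
  set r : ℝ := ν h + 2 * ν h' with hr
  have hhr : ν h < r := by rw [hr]; linarith
  have hh'r : ν h' < r := by rw [hr]; linarith
  have hr3 : r ≤ 3 * ν h := by rw [hr]; linarith
  have hρr : 3 * r ≤ ρ₀ := by linarith
  have hRr : 6 * r ≤ R := by linarith
  have hlr : ∀ l ∈ Icc 1 L, |((l : ℤ) : ℝ)| * ν h' < r := by
    intro l hl
    rw [mem_Icc] at hl
    have : ((l : ℤ) : ℝ) = (l : ℝ) := by push_cast; ring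
    rw [this, abs_of_nonneg (Nat.cast_nonneg _)]
    have : (l : ℝ) * ν h' ≤ L * ν h' := by
      have : (l : ℝ) ≤ L := by exact_mod_cast hl.2
      exact mul_le_mul_of_nonneg_right this hh'0.le
    rw [hr]; linarith
  -- the per-`l` denominators
  have hstep : ∀ l ∈ Icc 1 L, ∃ p : ℕ × ℕ, (1 ≤ p.1 ∧ (p.1 : ℝ) ≤ Q₁ ∧ 1 ≤ p.2 ∧ (p.2 : ℝ) ≤ Q₁) ∧
      ‖((((p.1 * p.2 : ℕ) : ℤ) * (4 * (l : ℤ)))) • D‖ ≤ 18 * Q₁ * K * r ^ 2 := by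
    intro l hl
    obtain ⟨q₁, q₂, h1, h2, h3, h4, hb⟩ := depolarize_step ν hν0 hνnn hνneg hνadd φ hφ hK hQ₁ h26
      (l : ℤ) hhr hh'r (hlr l hl) hρr hRr
    exact ⟨(q₁, q₂), ⟨h1, h2, h3, h4⟩, hb⟩
  choose! f hf using hstep
  set Qn : ℕ := ⌊Q₁⌋₊ with hQn
  have hQn1 : 1 ≤ Qn := by rw [hQn]; exact Nat.le_floor (by exact_mod_cast hQ₁)
  set t : Finset (ℕ × ℕ) := Icc 1 Qn ×ˢ Icc 1 Qn with ht
  have htne : t.Nonempty := ⟨(1, 1), by simp [ht, hQn1]⟩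
  have hft : ∀ l ∈ Icc 1 L, f l ∈ t := by
    intro l hl
    obtain ⟨⟨h1, h2, h3, h4⟩, _⟩ := hf l hl
    rw [ht, mem_product, mem_Icc, mem_Icc, hQn]
    exact ⟨⟨h1, Nat.le_floor h2⟩, ⟨h3, Nat.le_floor h4⟩⟩
  have hcardt : (#t : ℝ) ≤ Q₁ ^ 2 := by
    rw [ht, card_product, Nat.card_Icc, show Qn + 1 - 1 = Qn by omega]; push_cast
    have hQnQ : (Qn : ℝ) ≤ Q₁ := Nat.floor_le (by linarith)
    have : (0 : ℝ) ≤ Qn := Nat.cast_nonneg _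
    nlinarith
  obtain ⟨p, hpt, hfib⟩ := exists_popular_value L t htne f hft
  rw [ht, mem_product, mem_Icc, mem_Icc] at hpt
  set q : ℕ := p.1 * p.2 with hq
  have hq1 : 1 ≤ q := Nat.one_le_iff_ne_zero.2 (Nat.mul_ne_zero (by omega) (by omega))
  have hQnQ : (Qn : ℝ) ≤ Q₁ := Nat.floor_le (by linarith)
  have hqQ : (q : ℝ) ≤ Q₁ ^ 2 := by
    rw [hq]; push_cast
    have h1 : (p.1 : ℝ) ≤ Q₁ := le_trans (by exact_mod_cast hpt.1.2) hQnQ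
    have h2 : (p.2 : ℝ) ≤ Q₁ := le_trans (by exact_mod_cast hpt.2.2) hQnQ
    have : (0 : ℝ) ≤ p.1 := Nat.cast_nonneg _
    have : (0 : ℝ) ≤ p.2 := Nat.cast_nonneg _
    nlinarith
  -- a real representative of `D` and the recurrent linear phase `α = 4 q x`
  obtain ⟨x, hx⟩ : ∃ x : ℝ, (x : UnitAddCircle) = D := QuotientAddGroup.mk_surjective D
  set α : ℝ := 4 * q * x with hα
  set δ₁ : ℝ := 162 * Q₁ * K * ν h ^ 2 with hδ₁
  have hε₀ : 18 * Q₁ * K * r ^ 2 ≤ δ₁ := by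
    rw [hδ₁]
    have : r ^ 2 ≤ (3 * ν h) ^ 2 := pow_le_pow_left₀ (by rw [hr]; positivity) hr3 2
    nlinarith [mul_nonneg (mul_nonneg (by norm_num : (0:ℝ) ≤ 18) (by linarith : (0:ℝ) ≤ Q₁)) hK]
  have hgood : ∀ l ∈ (Icc 1 L).filter (fun l => f l = p),
      ‖((α * (((0 : ℤ) : ℝ) + l) : ℝ) : UnitAddCircle)‖ ≤ δ₁ := by
    intro l hl
    rw [mem_filter] at hl
    obtain ⟨hl, hfl⟩ := hl
    have hb := (hf l hl).2
    rw [hfl] at hb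
    have e : ((α * (((0 : ℤ) : ℝ) + l) : ℝ) : UnitAddCircle) = ((((p.1 * p.2 : ℕ) : ℤ) * (4 * (l : ℤ)))) • D := by
      rw [← hx, ← AddCircle.coe_zsmul]
      congr 1
      rw [zsmul_eq_mul, hα, hq]; push_cast; ring
    rw [e]
    exact hb.trans hε₀
  have hcount : (1 / Q₁ ^ 2) * L ≤ #((Icc 1 L).filter fun l : ℕ =>
      ‖((α * (((0 : ℤ) : ℝ) + l) : ℝ) : UnitAddCircle)‖ ≤ δ₁) := by
    have hsub : (Icc 1 L).filter (fun l => f l = p) ⊆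
        (Icc 1 L).filter fun l : ℕ => ‖((α * (((0 : ℤ) : ℝ) + l) : ℝ) : UnitAddCircle)‖ ≤ δ₁ := by
      intro l hl
      rw [mem_filter]
      exact ⟨(mem_filter.1 hl).1, hgood l hl⟩
    have h1 : (L : ℝ) / #t ≥ (1 / Q₁ ^ 2) * L := by
      rw [ge_iff_le, one_div_mul_eq_div]
      exact div_le_div_of_nonneg_left (Nat.cast_nonneg _) (by exact_mod_cast htne.card_pos) hcardt
    calc (1 / Q₁ ^ 2) * (L : ℝ) ≤ (L : ℝ) / #t := h1
      _ ≤ #((Icc 1 L).filter fun l => f l = p) := hfib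
      _ ≤ _ := by exact_mod_cast card_le_card hsub
  have hδ₂ : (0 : ℝ) < 1 / Q₁ ^ 2 := by positivity
  have hδ₂1 : 1 / Q₁ ^ 2 ≤ 1 := by
    rw [div_le_one (by positivity)]; exact one_le_pow₀ hQ₁
  have hδ₁0 : 0 ≤ δ₁ := by rw [hδ₁]; positivity
  have hδ₁₂ : δ₁ ≤ (1 / Q₁ ^ 2) / 4 := by
    rw [hδ₁, div_div, le_div_iff₀ (by positivity)]
    have h1 : ν h ^ 2 ≤ ρ₂ ^ 2 := pow_le_pow_left₀ (hνnn h) hh.le 2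
    have h2 : 162 * Q₁ * K * ν h ^ 2 ≤ 162 * Q₁ * K * ρ₂ ^ 2 :=
      mul_le_mul_of_nonneg_left h1 (by positivity)
    calc 162 * Q₁ * K * ν h ^ 2 * (Q₁ ^ 2 * 4) ≤ 162 * Q₁ * K * ρ₂ ^ 2 * (Q₁ ^ 2 * 4) :=
          mul_le_mul_of_nonneg_right h2 (by positivity)
      _ = 648 * Q₁ ^ 3 * K * ρ₂ ^ 2 := by ring
      _ ≤ 1 := hsmall
  -- Case split on `L`
  by_cases hLbig : 2 < (1 / Q₁ ^ 2) ^ 2 * L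
  · obtain ⟨q', hq'1, hq'le, hq'b⟩ :=
      exists_norm_mul_le_of_many_small_amplified α 0 hδ₂ hδ₂1 hδ₁0 hδ₁₂ hLbig hcount
    refine ⟨q' * (4 * q), Nat.one_le_iff_ne_zero.2 (Nat.mul_ne_zero (by omega) (by omega)), ?_, ?_⟩
    · push_cast
      have h1 : (q' : ℝ) ≤ 6418 * Q₁ ^ 4 := by
        refine hq'le.trans (le_of_eq ?_); field_simp
      have : (0 : ℝ) ≤ q' := Nat.cast_nonneg _
      have : (0 : ℝ) ≤ q := Nat.cast_nonneg _
      nlinarith [mul_le_mul h1 hqQ this (by positivity)]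
    · have e : (((q' * (4 * q) : ℕ) : ℤ)) • D = ((((q' : ℝ) * α : ℝ)) : UnitAddCircle) := by
        rw [← hx, ← AddCircle.coe_zsmul]
        congr 1
        rw [zsmul_eq_mul, hα]; push_cast; ring
      rw [e]
      refine hq'b.trans ?_
      rw [hδ₁]
      exact large_case_arith hQ₁ hK hνh.le (by exact_mod_cast hL1) hLlt.le
  · -- small `L`: use `l = 1`
    push Not at hLbig
    have h1L : 1 ∈ Icc 1 L := by rw [mem_Icc]; omega
    obtain ⟨⟨h1, h2, h3, h4⟩, hb⟩ := hf 1 h1L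
    clear hf hft hgood hcount h26 hφ
    refine ⟨(f 1).1 * (f 1).2 * 4,
      Nat.one_le_iff_ne_zero.2 (Nat.mul_ne_zero (Nat.mul_ne_zero (by omega) (by omega)) (by norm_num)),
      ?_, ?_⟩
    · push_cast
      have hf1 : (0 : ℝ) ≤ (f 1).1 := Nat.cast_nonneg _
      have hQ0 : (0 : ℝ) ≤ Q₁ := by linarith
      have hprod : ((f 1).1 : ℝ) * (f 1).2 ≤ Q₁ * Q₁ := mul_le_mul h2 h4 (Nat.cast_nonneg _) hQ0
      have hQ6 : Q₁ * Q₁ ≤ Q₁ ^ 6 := by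
        rw [← sq]; exact pow_le_pow_right₀ hQ₁ (by norm_num)
      have h46 : (0 : ℝ) ≤ Q₁ ^ 6 := by positivity
      calc ((f 1).1 : ℝ) * (f 1).2 * 4 ≤ Q₁ ^ 6 * 4 :=
            mul_le_mul_of_nonneg_right (hprod.trans hQ6) (by norm_num)
        _ ≤ 25672 * Q₁ ^ 6 := by linarith
    · have e : ((((f 1).1 * (f 1).2 * 4 : ℕ) : ℤ)) • D =
          ((((f 1).1 * (f 1).2 : ℕ) : ℤ) * (4 * ((1 : ℕ) : ℤ))) • D := by
        have hz : (((f 1).1 * (f 1).2 * 4 : ℕ) : ℤ) = (((f 1).1 * (f 1).2 : ℕ) : ℤ) * (4 * ((1 : ℕ) : ℤ)) := by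
          push_cast; ring
        rw [hz]
      rw [e]
      refine (hb.trans hε₀).trans ?_
      -- `L ≤ 2 Q₁⁴` gives `ν h < L ν h' ≤ 2Q₁⁴ ν h'`
      have hLs : (L : ℝ) ≤ 2 * Q₁ ^ 4 := by
        have e2 : (1 / Q₁ ^ 2) ^ 2 * (L : ℝ) = L / Q₁ ^ 4 := by field_simp
        rw [e2, div_le_iff₀ (by positivity)] at hLbig
        linarith
      have h3 : ν h ≤ 2 * Q₁ ^ 4 * ν h' :=
        hLlt.le.trans (mul_le_mul_of_nonneg_right hLs hh'0.le)
      rw [hδ₁]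
      have hQ5 : Q₁ ^ 5 ≤ Q₁ ^ 13 := pow_le_pow_right₀ hQ₁ (by norm_num)
      have hKnn : 0 ≤ K * ν h * ν h' := by
        have := hνnn h; have := hh'0.le; positivity
      calc 162 * Q₁ * K * ν h ^ 2 = (162 * Q₁ * K * ν h) * ν h := by ring
        _ ≤ (162 * Q₁ * K * ν h) * (2 * Q₁ ^ 4 * ν h') :=
            mul_le_mul_of_nonneg_left h3 (by have := hνnn h; positivity)
        _ = 324 * Q₁ ^ 5 * (K * ν h * ν h') := by ring
        _ ≤ 324 * Q₁ ^ 13 * (K * ν h * ν h') :=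
            mul_le_mul_of_nonneg_right (mul_le_mul_of_nonneg_left hQ5 (by norm_num)) hKnn
        _ ≤ 426133840896 * Q₁ ^ 13 * (K * ν h * ν h') :=
            mul_le_mul_of_nonneg_right (mul_le_mul_of_nonneg_right (by norm_num) (by positivity)) hKnn
        _ = 426133840896 * Q₁ ^ 13 * K * ν h * ν h' := by ring

end Summit.Parity.GeneralizedHardyLittlewood.GreenTaoLevelTwoMNTwoDepolarize
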